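import Literature.MathematicalPhysics.QuantumLattice.ParticleHoleVariationalPressure
import HarnessLib

/-!
# Particle–hole transformed states: entropy, energies, equilibria — half filling of the Hubbard model

Sequel of `ParticleHoleVariationalPressure` (interactions, pressures) and `InfVolFermionStateParticleHole` (the state `ω ∘ α`):

* §1 `rdm_particleHole`: `ρ^{ω∘α}_Λ = α_Λ(ρ^ω_Λ) = P_Λ ρ_Λ P_Λᴴ`, hence **the mean entropy is particle–hole invariant** (`entropyDensitySup_particleHole`);
  `E_{Ψ^α} = α(E_Ψ)`, `e_Ψ(ω ∘ α) = e_{Ψ^α}(ω)`.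
* §2 **translation-invariant equilibrium states are carried to equilibrium states**: `ω` equilibrium for `(β, Ψ)` ⇒ `ω ∘ α` equilibrium for
  `(β, Ψ^α)` (`IsVarEquilibrium.particleHole`; `d ≥ 1`, `Ψ` Hermitian even translation covariant of finite range); constant shifts do not change
  the equilibrium states (`isVarEquilibrium_pencil_onSiteUnit_iff`); for the Hubbard model: equilibria at `(μ, h)` ↔ equilibria at `(U − μ, −h)` with
  `ρ ↦ 2 − ρ` (`IsVarEquilibrium.particleHole_hubbardZeeman`).
* §3 **HALF FILLING** (`μ = U/2`, `h = 0`, every `β > 0`, `t`, `U`, `d ≥ 1`): the set of translation-invariant equilibrium states is particle–hole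
  symmetric; **a state with `ρ ≠ 1` comes with a second one of density `2 − ρ`** (`exists_ne_isVarEquilibrium_of_density_ne_one`); and the symmetric
  Griffiths window **`|ρ(ω) − 1| ≤ (P(β; −U/2 − δ, 0) − P(β; −U/2, 0))/(βδ) − 1`** for every `δ > 0` (`IsVarEquilibrium.abs_density_sub_one_le`) —
  certifiable from two boxes by `FermionVariationalPrincipleBoxCertificates`.

Everything is PROVED; no definition, no named fact, no number. HONEST SCOPE: differentiability of `P` in `μ` (which would give `ρ = 1` exactly) is
not claimed.

## Tree / Mathlib search

REUSED: `InfVolFermionState.particleHole`, `particleHole_expect`, `particleHole_particleHole`, `IsTranslationInvariant.particleHole`, `density_particleHole`,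
`phAut(_phAut)`, `fermionEmbed_incl_phAut`, `particleHoleAut_apply`, `particleHole_mul_conjTranspose` (`InfVolFermionStateParticleHole`, `HubbardModelParticleHoleProofs`);
`FermionInteraction.particleHole`, `varPressure_particleHole`, `particleHole_hubbardZeeman(_halfFilling)`, `varPressure_hubbardZeeman_particleHole`, `onSiteUnit`,
`meanEnergy_onSiteUnit`, `varPressure_pencil_onSiteUnit`, `phUnitary_conjTranspose_mul` (`ParticleHoleVariationalPressure`); `rdm`, `trace_rdm_mul`, `rdm_isHermitian`,
`IsTranslationInvariant.isEven`; `vonNeumannEntropy_unitary_conj` (`ConditionalEntropyConcavity`); `IsVarEquilibrium(.meanEnergy_mem_Icc)`, `meanEnergy_pencil`,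
`meanEnergy_numberInteraction`; Mathlib `Matrix.trace_mul_cycle`, `Matrix.trace_single_mul`, `Matrix.mem_unitaryGroup_iff`.

## References

* E. H. Lieb, Phys. Rev. Lett. 62 (1989) 1201, proof of Theorem 2.
* R. B. Israel, *Convexity in the Theory of Lattice Gases* (1979), Thm. I.2.4, §IV.2.
* O. Bratteli, D. W. Robinson, *OAQSM 2* (1997), Prop. 6.2.15 (entropy is invariant under quasi-local automorphisms).
-/

noncomputable section

open scoped ComplexOrder BigOperators
open Finset Filter Topology

namespace Literature.MathematicalPhysics.QuantumLattice

open Matrix HubbardWave0 Literature.Probability.LatticeModels ThermodynamicLimit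
open Literature.InformationTheory.Entropy (vonNeumannEntropy vonNeumannEntropy_unitary_conj)

variable {d : ℕ}

/-! ### §1. Density matrices, entropy and energies of `ω ∘ α` -/

/-- The trace is invariant under `α_Λ` (private copy of `trace_phAut` of `MarkovCertificateParticleHole`, to keep imports light). [folklore] -/
private theorem trace_phAut' {Λ : Finset (Site d)} (M : FermionOp Λ) : (phAut Λ M).trace = M.trace := by
  rw [phAut, particleHoleAut_apply, Matrix.trace_mul_cycle, phUnitary_conjTranspose_mul, Matrix.one_mul]

/-- The staggered particle–hole matrix of a region is unitary. [cite: Tasaki2020, §9.3.3] -/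
theorem phUnitary_mem_unitaryGroup (Λ : Finset (Site d)) :
    particleHole (fun i : Orb (PolySite Λ) => (((phSign Λ i : ℤˣ) : ℤ) : ℂ)) ∈ Matrix.unitaryGroup (Finset (Orb (PolySite Λ))) ℂ := by
  rw [Matrix.mem_unitaryGroup_iff, Matrix.star_eq_conjTranspose]
  exact particleHole_mul_conjTranspose _ fun i => by
    rcases Int.units_eq_one_or (phSign Λ i) with h | h <;> simp [h]

namespace InfVolFermionState

variable (ω : InfVolFermionState d)

/-- **The density matrices of `ω ∘ α` are the transformed ones**: `ρ^{ω∘α}_Λ = α_Λ(ρ^ω_Λ)`. [cite: BratteliRobinsonII1997, §5.2.2 Thm. 5.2.5] -/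
theorem rdm_particleHole (Λ : Finset (Site d)) : ω.particleHole.rdm Λ = phAut Λ (ω.rdm Λ) := by
  ext s t
  have key : ∀ A : FermionOp Λ, ω.particleHole.expect Λ A = (phAut Λ (ω.rdm Λ) * A).trace := by
    intro A
    rw [particleHole_expect, ← trace_rdm_mul]
    conv_lhs => rw [← phAut_phAut (ω.rdm Λ)]
    rw [← map_mul, trace_phAut']
  rw [rdm_apply, key, Matrix.trace_mul_comm, Matrix.trace_single_mul, one_smul]

/-- **Box entropies are particle–hole invariant.** [cite: BratteliRobinsonII1997, Prop. 6.2.15] -/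
theorem vonNeumannEntropy_rdm_particleHole (Λ : Finset (Site d)) :
    vonNeumannEntropy (ω.particleHole.rdm Λ) = vonNeumannEntropy (ω.rdm Λ) := by
  rw [rdm_particleHole, phAut, particleHoleAut_apply]
  exact vonNeumannEntropy_unitary_conj (phUnitary_mem_unitaryGroup Λ) (ω.rdm_isHermitian Λ)

/-- The box-entropy densities are particle–hole invariant. [cite: BratteliRobinsonII1997, Prop. 6.2.15] -/
theorem boxEntropyDensity_particleHole : ω.particleHole.boxEntropyDensity = ω.boxEntropyDensity := by
  funext ℓ
  rw [boxEntropyDensity_apply, boxEntropyDensity_apply, vonNeumannEntropy_rdm_particleHole]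

/-- **The mean entropy is particle–hole invariant**: `s̄(ω ∘ α) = s̄(ω)`. [cite: BratteliRobinsonII1997, Prop. 6.2.15] -/
theorem entropyDensitySup_particleHole : ω.particleHole.entropyDensitySup = ω.entropyDensitySup := by
  rw [entropyDensitySup, entropyDensitySup, boxEntropyDensity_particleHole]

end InfVolFermionState

namespace FermionInteraction

/-- **`E_{Ψ^α} = α(E_Ψ)`.** [cite: BratteliKishimotoRobinson1978, §3 (mean energy functional)] -/
theorem particleHole_meanEnergyObs (Ψ : FermionInteraction d) (R : ℝ) :
    Ψ.particleHole.meanEnergyObs R = phAut _ (Ψ.meanEnergyObs R) := by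
  unfold meanEnergyObs
  rw [map_sum]
  refine Finset.sum_congr rfl fun X _ => ?_
  rw [map_smul, ← fermionEmbed_incl_phAut]
  rfl

end FermionInteraction

namespace InfVolFermionState

variable (ω : InfVolFermionState d)

/-- **`e_Ψ(ω ∘ α) = e_{Ψ^α}(ω)`.** [cite: BratteliKishimotoRobinson1978, §3 (mean energy functional)] -/
theorem meanEnergy_particleHole (Ψ : FermionInteraction d) (R : ℝ) : ω.particleHole.meanEnergy Ψ R = ω.meanEnergy Ψ.particleHole R := by
  rw [meanEnergy, meanEnergy, particleHole_expect, Ψ.particleHole_meanEnergyObs]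

/-- `e_{Ψ^α}(ω ∘ α) = e_Ψ(ω)`. [cite: BratteliKishimotoRobinson1978, §3] -/
theorem meanEnergy_particleHole_particleHole (Ψ : FermionInteraction d) (R : ℝ) :
    ω.particleHole.meanEnergy Ψ.particleHole R = ω.meanEnergy Ψ R := by
  rw [meanEnergy_particleHole, Ψ.particleHole_particleHole]

/-! ### §2. Equilibria under the particle–hole transformation -/

variable {ω} {β R : ℝ} {Ψ : FermionInteraction d}

/-- **`α` carries translation-invariant equilibrium states of `Ψ` to those of `Ψ^α`** (`d ≥ 1`; `Ψ` Hermitian, even, translation covariant, finite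
range `R`). [cite: Israel1979, Thm. I.2.4] [cite: BratteliRobinsonII1997, Prop. 6.2.15] -/
theorem IsVarEquilibrium.particleHole (hd : 0 < d) (hH : Ψ.IsHermitian) (hE : Ψ.IsEven) (hT : Ψ.IsTranslationInvariant) (hR : Ψ.HasFiniteRange R)
    (h : ω.IsVarEquilibrium β Ψ R) : ω.particleHole.IsVarEquilibrium β Ψ.particleHole R := by
  refine ⟨h.1.particleHole (h.1.isEven hd), ?_⟩
  rw [entropyDensitySup_particleHole, meanEnergy_particleHole_particleHole, FermionInteraction.varPressure_particleHole hd hH hE hT hR]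
  exact h.2

/-- **Constant energy shifts do not change the equilibrium states**: `ω` is an equilibrium state of `Ψ + c·𝟙` iff of `Ψ`. [cite: Israel1979, Thm. I.2.4] -/
theorem isVarEquilibrium_pencil_onSiteUnit_iff (Ψ : FermionInteraction d) (c : ℝ) :
    ω.IsVarEquilibrium β (Ψ.pencil (onSiteUnit d) c) R ↔ ω.IsVarEquilibrium β Ψ R := by
  simp only [IsVarEquilibrium, Ψ.varPressure_pencil_onSiteUnit, meanEnergy_pencil, meanEnergy_onSiteUnit, mul_one]
  constructor
  · rintro ⟨hT, h⟩
    exact ⟨hT, by linarith⟩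
  · rintro ⟨hT, h⟩
    exact ⟨hT, by linarith⟩

/-- **Equilibria of the Hubbard model at `(a, b)` go to equilibria at `(−U − a, −b)`** (i.e. `(μ, h) ↦ (U − μ, −h)`), with density `2 − ρ`
(`density_particleHole`). (`d ≥ 1`, `R ≥ 1`, every real `β`.) [cite: LiebPRL1989, proof of Theorem 2] [cite: Israel1979, Thm. I.2.4] -/
theorem IsVarEquilibrium.particleHole_hubbardZeeman (hd : 0 < d) {t U a b : ℝ} (hR : 1 ≤ R)
    (h : ω.IsVarEquilibrium β (hubbardZeeman d t U ![a, b]) R) : ω.particleHole.IsVarEquilibrium β (hubbardZeeman d t U ![-U - a, -b]) R := by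
  obtain ⟨hH, hE, hT, hR1⟩ := hubbardZeeman_structure (d := d) t U ![a, b]
  have hRR : (hubbardZeeman d t U ![a, b]).HasFiniteRange R := fun X hX => hR1 X (lt_of_le_of_lt hR hX)
  have h' := h.particleHole hd hH hE hT hRR
  rw [Literature.MathematicalPhysics.QuantumLattice.particleHole_hubbardZeeman] at h'
  exact (isVarEquilibrium_pencil_onSiteUnit_iff _ _).1 h'

/-! ### §3. Half filling -/

/-- **At `μ = U/2`, `h = 0` the set of translation-invariant equilibrium states is particle–hole symmetric** (`d ≥ 1`, `R ≥ 1`).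
[cite: LiebPRL1989, proof of Theorem 2] -/
theorem IsVarEquilibrium.particleHole_halfFilling (hd : 0 < d) {t U : ℝ} (hR : 1 ≤ R)
    (h : ω.IsVarEquilibrium β (hubbardZeeman d t U ![-U / 2, 0]) R) : ω.particleHole.IsVarEquilibrium β (hubbardZeeman d t U ![-U / 2, 0]) R := by
  have h' := h.particleHole_hubbardZeeman hd hR
  rwa [show -U - -U / 2 = -U / 2 by ring, neg_zero] at h'

/-- **Density `≠ 1` at half-filling parameters means coexistence**: a translation-invariant equilibrium state with `ρ(ω) ≠ 1` comes with a second,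
different one of density `2 − ρ(ω)`. [cite: Israel1979, Thm. I.2.4] -/
theorem exists_ne_isVarEquilibrium_of_density_ne_one (hd : 0 < d) {t U : ℝ} (hR : 1 ≤ R)
    (h : ω.IsVarEquilibrium β (hubbardZeeman d t U ![-U / 2, 0]) R) (hρ : ω.density ≠ 1) :
    ∃ ω' : InfVolFermionState d, ω'.IsVarEquilibrium β (hubbardZeeman d t U ![-U / 2, 0]) R ∧ ω' ≠ ω ∧ ω'.density = 2 - ω.density := by
  refine ⟨ω.particleHole, h.particleHole_halfFilling hd hR, fun heq => hρ ?_, ω.density_particleHole⟩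
  have h1 := ω.density_particleHole
  rw [heq] at h1
  linarith

/-- **THE HALF-FILLING DENSITY WINDOW**: for every translation-invariant equilibrium state `ω` of the Hubbard model at `μ = U/2`, `h = 0`
(`β > 0`, `R ≥ 1`, `d ≥ 1`) and every `δ > 0`: `|ρ(ω) − 1| ≤ (P(β; −U/2 − δ, 0) − P(β; −U/2, 0))/(βδ) − 1` — the Griffiths window made symmetric by
the particle–hole identity of the pressure. [cite: Griffiths1964, Eq. (39) and Fig. 3] [cite: LiebPRL1989, proof of Theorem 2] -/
theorem IsVarEquilibrium.abs_density_sub_one_le (hd : 0 < d) (hβ : 0 < β) {t U : ℝ} (hR : 1 ≤ R)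
    (h : ω.IsVarEquilibrium β (hubbardZeeman d t U ![-U / 2, 0]) R) {δ : ℝ} (hδ : 0 < δ) :
    |ω.density - 1| ≤
      ((hubbardZeeman d t U ![-U / 2 - δ, 0]).varPressure β R - (hubbardZeeman d t U ![-U / 2, 0]).varPressure β R) / (β * δ) - 1 := by
  have h' : ω.IsVarEquilibrium β
      (FermionInteraction.linearFamily (hubbardFermionInteraction d t U) ![numberInteraction d, spinImbalanceInteraction d] ![-U / 2, 0]) R := h
  have hw := h'.meanEnergy_mem_Icc hβ 0 hδ
  have e1 : (![-U / 2, 0] : Fin 2 → ℝ) + Pi.single 0 δ = ![-U / 2 + δ, 0] := by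
    funext i
    fin_cases i <;> simp
  have e2 : (![-U / 2, 0] : Fin 2 → ℝ) + Pi.single 0 (-δ) = ![-U / 2 - δ, 0] := by
    funext i
    fin_cases i <;> simp [sub_eq_add_neg]
  rw [e1, e2, show (![numberInteraction d, spinImbalanceInteraction d] : Fin 2 → FermionInteraction d) 0 = numberInteraction d from rfl,
    meanEnergy_numberInteraction] at hw
  change ω.density ∈ Set.Icc
      (((hubbardZeeman d t U ![-U / 2, 0]).varPressure β R - (hubbardZeeman d t U ![-U / 2 + δ, 0]).varPressure β R) / (β * δ))
      (((hubbardZeeman d t U ![-U / 2 - δ, 0]).varPressure β R - (hubbardZeeman d t U ![-U / 2, 0]).varPressure β R) / (β * δ)) at hw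
  -- the particle–hole identity: `P(−U/2 + δ, 0) = P(−U/2 − δ, 0) − 2βδ`
  have hph := varPressure_hubbardZeeman_particleHole hd t U (-U / 2 + δ) 0 β hR
  rw [show -U - (-U / 2 + δ) = -U / 2 - δ by ring, neg_zero, show U + 2 * (-U / 2 + δ) = 2 * δ by ring] at hph
  have hβδ : 0 < β * δ := mul_pos hβ hδ
  set P0 := (hubbardZeeman d t U ![-U / 2, 0]).varPressure β R
  set Pm := (hubbardZeeman d t U ![-U / 2 - δ, 0]).varPressure β R
  rw [hph] at hw
  have hlo : 2 - (Pm - P0) / (β * δ) ≤ ω.density := by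
    have h1 := hw.1
    have : (P0 - (Pm - β * (2 * δ))) / (β * δ) = 2 - (Pm - P0) / (β * δ) := by
      field_simp
      ring
    linarith [this ▸ h1]
  rw [abs_le]
  constructor <;> linarith [hw.2]

end InfVolFermionState

end Literature.MathematicalPhysics.QuantumLattice

end
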